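import Summits.NavierStokesRegularity.FunctionalMining.ThreeWaveWitness
import Literature.Analysis.FluidPDE.TorusVorticityTensorTransport
import HarnessLib

/-!
# Three-wave field: strain, vorticity and the middle strain eigenvalue (K1-Q2 kernel instance, part 1/3)

NS FUNCTIONAL MINING cell (`pub-nsfunc`), dictionary seat — **search for candidate a priori
estimates; no regularity claim.** Nothing here asserts anything about Navier–Stokes regularity.

For the tree's three-wave field `w = ThreeWaveTorus.w` (p195100) this part proves: the eigenvalue kit
`det(t − M) ≤ 0 ∧ t ≥ 0 ⇒ λ₂(M) ≤ t` for real symmetric trace-free `3×3` matrices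
(`middle_le_of_det_branch`, via `det = ∏λᵢ`, `Σλᵢ = 0`); the nine first derivatives of `w` in characters
(only `p = ∂₁w₀`, `q = ∂₀w₂`, `r = ∂₁w₂` are non-zero); hence `|ω|² = p²+q²+r²`, `σ = ωᵀSω = −pqr`,
`‖S‖_F² = |ω|²/2 ≤ 12(2π)²` (an SOS identity modulo `|X| = |Y| = 1`), `det S = pqr/4`, and
`λ₂(S(x)) ≤ |p(x)|/2 ≤ Λ := 2π` for every `x` (`middleEigenvalue_le_w`; the sharp sup is `(√3−1)·2π`).
Parts 2/3: `ThreeWaveFourierTables` (exact Fourier tables of `|ω|², σ, |ω|⁴`) and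
`MiddleEigenvalueThreeWaveKill` (the integrals and `¬ MiddleEigenvalueMomentRateBound 4 C` for every
`C < 36/23`, `¬ … 6 C` for every `C < 507/172`; in particular `¬ (4, 1)`, `¬ (4, 3/2)`, `¬ (6, 2)`).
Search for candidate a priori estimates; no regularity claim.
-/

noncomputable section

open Set MeasureTheory Complex Finset
open scoped RealInnerProductSpace ComplexConjugate

namespace Summit.NavierStokesRegularity.FunctionalMining

open Literature.Analysis Literature.Analysis.FunctionSpaces Literature.Analysis.FunctionSpaces.Torus
open Literature.Analysis.FluidPDE UnitAddTorus
open ThreeWaveTorus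

namespace MiddleEigenKill

set_option linter.unusedSimpArgs false
set_option linter.unusedTactic false
set_option linter.unreachableTactic false
set_option linter.unnecessarySeqFocus false

/-! ## 1. Eigenvalue kit: the determinant branch `det(t − M) ≤ 0, t ≥ 0 ⇒ λ₂ ≤ t` (symmetric trace-free `3 × 3`) -/

/-- `tr(M²) = ∑ λᵢ²` for a real symmetric matrix. [folklore] -/
theorem trace_mul_self_eq_sum_sq {n : Type*} [Fintype n] [DecidableEq n] {M : Matrix n n ℝ}
    (hM : M.IsHermitian) : (M * M).trace = ∑ i, hM.eigenvalues i ^ 2 := by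
  have hspec := hM.spectral_theorem
  set U := hM.eigenvectorUnitary with hU
  have h2 : M * M = (U : Matrix n n ℝ) * Matrix.diagonal (fun i => hM.eigenvalues i ^ 2) *
      (star (U : Matrix n n ℝ)) := by
    have hD : Matrix.diagonal (RCLike.ofReal ∘ hM.eigenvalues : n → ℝ) =
        Matrix.diagonal hM.eigenvalues := by
      congr 1
    conv_lhs => rw [hspec]
    rw [Unitary.conjStarAlgAut_apply, hD]
    have hUU : (star (U : Matrix n n ℝ)) * (U : Matrix n n ℝ) = 1 := Unitary.coe_star_mul_self U
    calc (U : Matrix n n ℝ) * Matrix.diagonal hM.eigenvalues * star (U : Matrix n n ℝ) *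
          ((U : Matrix n n ℝ) * Matrix.diagonal hM.eigenvalues * star (U : Matrix n n ℝ))
        = (U : Matrix n n ℝ) * Matrix.diagonal hM.eigenvalues *
            ((star (U : Matrix n n ℝ)) * (U : Matrix n n ℝ)) * Matrix.diagonal hM.eigenvalues *
            star (U : Matrix n n ℝ) := by simp only [Matrix.mul_assoc]
      _ = (U : Matrix n n ℝ) * Matrix.diagonal (fun i => hM.eigenvalues i ^ 2) *
            star (U : Matrix n n ℝ) := by
          rw [hUU, Matrix.mul_one, Matrix.mul_assoc (U : Matrix n n ℝ), Matrix.diagonal_mul_diagonal]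
          simp only [pow_two]
  rw [h2, Matrix.trace_mul_cycle, Unitary.coe_star_mul_self, Matrix.one_mul, Matrix.trace_diagonal]

/-- `tr(M²) = ∑ᵢⱼ Mᵢⱼ²` for a symmetric matrix. [folklore] -/
theorem trace_mul_self_eq_sum_sq_entries {n : Type*} [Fintype n] {M : Matrix n n ℝ}
    (hsym : M.IsSymm) : (M * M).trace = ∑ i, ∑ j, M i j ^ 2 := by
  simp only [Matrix.trace, Matrix.diag, Matrix.mul_apply]
  refine Finset.sum_congr rfl fun i _ => Finset.sum_congr rfl fun j _ => ?_
  rw [pow_two]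
  congr 1
  exact (hsym.apply j i).symm

/-- **Determinant branch of the middle-eigenvalue criterion.** For a real symmetric trace-free
`3 × 3` matrix `M` and `t ≥ 0`: if `t³ − ½‖M‖_F²·t − det M ≤ 0` (that is, `det(t·1 − M) ≤ 0`) then
`λ₂(M) ≤ t`. (`det(t−M) = ∏(t−λᵢ)`; if `λ₂ > t ≥ 0` then `(t−λ₁)(t−λ₂) > 0` forces `λ₃ ≥ t ≥ 0`,
contradicting `Σλᵢ = 0`.) [folklore; elementary] -/
theorem middle_le_of_det_branch {n : Type*} [Fintype n] [DecidableEq n] (hn : Fintype.card n = 3)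
    (M : Matrix n n ℝ) (hsym : M.IsSymm) (htr : M.trace = 0) (hH : M.IsHermitian) {t : ℝ}
    (ht : 0 ≤ t) (hχ : t ^ 3 - (∑ i, ∑ j, M i j ^ 2) / 2 * t - M.det ≤ 0) :
    hH.eigenvalues₀ (Fin.cast hn.symm 1) ≤ t := by
  set lam : Fin 3 → ℝ := fun a => hH.eigenvalues₀ (Fin.cast hn.symm a) with hlam
  have hE : ∀ f : ℝ → ℝ, ∑ i, f (hH.eigenvalues i) = ∑ a : Fin 3, f (lam a) := by
    intro f
    have h1 : ∑ i, f (hH.eigenvalues i) = ∑ k, f (hH.eigenvalues₀ k) :=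
      Fintype.sum_equiv (Fintype.equivOfCardEq (Fintype.card_fin _)).symm _ _ (fun i => rfl)
    rw [h1]
    exact Fintype.sum_equiv (finCongr hn) _ _ (fun k => by simp [hlam, finCongr])
  have hP : ∏ i, hH.eigenvalues i = ∏ a : Fin 3, lam a := by
    have h1 : ∏ i, hH.eigenvalues i = ∏ k, hH.eigenvalues₀ k :=
      Fintype.prod_equiv (Fintype.equivOfCardEq (Fintype.card_fin _)).symm _ _ (fun i => rfl)
    rw [h1]
    exact Fintype.prod_equiv (finCongr hn) _ _ (fun k => by simp [hlam, finCongr])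
  have hdet : M.det = ∏ a : Fin 3, lam a := by
    have := hH.det_eq_prod_eigenvalues
    simp only [RCLike.ofReal_real_eq_id, id_eq] at this
    rw [this, hP]
  have htr' : ∑ a : Fin 3, lam a = 0 := by
    have := hH.trace_eq_sum_eigenvalues
    simp only [RCLike.ofReal_real_eq_id, id_eq] at this
    rw [← hE (fun x => x), ← this, htr]
  have hsq : ∑ i, ∑ j, M i j ^ 2 = ∑ a : Fin 3, lam a ^ 2 := by
    rw [← trace_mul_self_eq_sum_sq_entries hsym, trace_mul_self_eq_sum_sq hH, hE (fun x => x ^ 2)]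
  have hanti : Antitone lam := fun a b hab =>
    hH.eigenvalues₀_antitone ((Fin.cast_le_cast hn.symm).mpr hab)
  have h10 : lam 1 ≤ lam 0 := hanti (by decide)
  have h21 : lam 2 ≤ lam 1 := hanti (by decide)
  show lam 1 ≤ t
  rw [hdet, hsq] at hχ
  simp only [Fin.sum_univ_three, Fin.prod_univ_three] at htr' hχ
  have h3 : lam 2 = -lam 0 - lam 1 := by linarith
  rw [h3] at hχ
  -- `hχ : t^3 - (l0² + l1² + (−l0−l1)²)/2 · t − l0 l1 (−l0−l1) ≤ 0`, i.e. `(t−l0)(t−l1)(t+l0+l1) ≤ 0`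
  have hfac : (t - lam 0) * (t - lam 1) * (t + lam 0 + lam 1) ≤ 0 := by nlinarith [hχ]
  by_contra hlt
  have h1 : t < lam 1 := lt_of_not_ge hlt
  have h0 : t < lam 0 := lt_of_lt_of_le h1 h10
  have hpos : 0 < (t - lam 0) * (t - lam 1) := mul_pos_of_neg_of_neg (by linarith) (by linarith)
  have hpos' : 0 < (t - lam 0) * (t - lam 1) * (t + lam 0 + lam 1) :=
    mul_pos hpos (by linarith)
  linarith


/-! ## 2. The three-wave field: the nine first derivatives -/

open ThreeWaveTorus

/-- `X = e_{e₁}(x)`, `Y = e_{e₂}(x)`: the two characters everything is a polynomial in. [folklore] -/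
theorem normSq_mFourier (n : Fin 3 → ℤ) (x : UnitAddTorus (Fin 3)) :
    (mFourier n x).re ^ 2 + (mFourier n x).im ^ 2 = 1 := by
  have h : ‖mFourier n x‖ = 1 := by
    simp only [mFourier, fourier_apply, ContinuousMap.coe_mk, norm_prod, Circle.norm_coe,
      Finset.prod_const_one]
  have h2 : ‖mFourier n x‖ ^ 2 = 1 := by rw [h, one_pow]
  rw [Complex.sq_norm, Complex.normSq_apply] at h2
  nlinarith [h2]

/-- `∂ᵢwⱼ(x) = Re ∑_{k∈S} e_k(x) (2πi kᵢ) ĉ(k)ⱼ`. [folklore] -/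
theorem partialDeriv_w_apply (i j : Fin 3) (x : UnitAddTorus (Fin 3)) :
    Torus.partialDeriv i w x j =
      (∑ k ∈ S, mFourier k x * ((2 * Real.pi * Complex.I * (k i : ℂ)) * c k j)).re := by
  rw [show w = realTrigPoly S c from rfl, partialDeriv_realTrigPoly, realTrigPoly_apply_coord,
    trigPoly_apply_coord]
  rfl

/-- `e12 = e1 + e2`. [ours; bookkeeping] -/
theorem e12_eq : e12 = e1 + e2 := by unfold e1 e2 e12; decide
/-- A coordinate of a basic mode (generated `rfl`). [ours; bookkeeping] -/
private theorem e1_0 : e1 0 = 1 := rfl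
/-- A coordinate of a basic mode (generated `rfl`). [ours; bookkeeping] -/
private theorem e1_1 : e1 1 = 0 := rfl
/-- A coordinate of a basic mode (generated `rfl`). [ours; bookkeeping] -/
private theorem e1_2 : e1 2 = 0 := rfl
/-- A coordinate of a basic mode (generated `rfl`). [ours; bookkeeping] -/
private theorem e2_0 : e2 0 = 0 := rfl
/-- A coordinate of a basic mode (generated `rfl`). [ours; bookkeeping] -/
private theorem e2_1 : e2 1 = 1 := rfl
/-- A coordinate of a basic mode (generated `rfl`). [ours; bookkeeping] -/
private theorem e2_2 : e2 2 = 0 := rfl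

/-- `p = ∂₁w₀ = −4π sin 2πx₁ = 2π(−2 Im Y)`. [folklore] -/
theorem partialDeriv_one_w_zero (x : UnitAddTorus (Fin 3)) :
    Torus.partialDeriv 1 w x 0 = 2 * Real.pi * (-2 * (mFourier e2 x).im) := by
  rw [partialDeriv_w_apply, sum_S, c_e1, c_neg_e1, c_e2, c_neg_e2, c_e12, c_neg_e12]
  simp only [mFourier_neg, e12_eq, mFourier_add, Pi.neg_apply, Pi.add_apply, e1_0, e1_1, e1_2, e2_0,
    e2_1, e2_2]
  simp [Complex.mul_re, Complex.mul_im, Complex.conj_re, Complex.conj_im]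
  ring

/-- `q = ∂₀w₂ = 2π(−2 Im X + 2 Re(XY))`. [folklore] -/
theorem partialDeriv_zero_w_two (x : UnitAddTorus (Fin 3)) :
    Torus.partialDeriv 0 w x 2 = 2 * Real.pi * (-2 * (mFourier e1 x).im +
        2 * ((mFourier e1 x).re * (mFourier e2 x).re - (mFourier e1 x).im * (mFourier e2 x).im)) := by
  rw [partialDeriv_w_apply, sum_S, c_e1, c_neg_e1, c_e2, c_neg_e2, c_e12, c_neg_e12]
  simp only [mFourier_neg, e12_eq, mFourier_add, Pi.neg_apply, Pi.add_apply, e1_0, e1_1, e1_2, e2_0,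
    e2_1, e2_2]
  simp [Complex.mul_re, Complex.mul_im, Complex.conj_re, Complex.conj_im]
  ring

/-- `r = ∂₁w₂ = 2π · 2 Re(XY)`. [folklore] -/
theorem partialDeriv_one_w_two (x : UnitAddTorus (Fin 3)) :
    Torus.partialDeriv 1 w x 2 = 2 * Real.pi *
        (2 * ((mFourier e1 x).re * (mFourier e2 x).re - (mFourier e1 x).im * (mFourier e2 x).im)) := by
  rw [partialDeriv_w_apply, sum_S, c_e1, c_neg_e1, c_e2, c_neg_e2, c_e12, c_neg_e12]
  simp only [mFourier_neg, e12_eq, mFourier_add, Pi.neg_apply, Pi.add_apply, e1_0, e1_1, e1_2, e2_0,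
    e2_1, e2_2]
  simp [Complex.mul_re, Complex.mul_im, Complex.conj_re, Complex.conj_im]
  ring

/-- The six vanishing first derivatives. [folklore] -/
theorem partialDeriv_w_zero (x : UnitAddTorus (Fin 3)) :
    Torus.partialDeriv 0 w x 0 = 0 ∧ Torus.partialDeriv 0 w x 1 = 0 ∧ Torus.partialDeriv 1 w x 1 = 0 ∧
    Torus.partialDeriv 2 w x 0 = 0 ∧ Torus.partialDeriv 2 w x 1 = 0 ∧ Torus.partialDeriv 2 w x 2 = 0 := by
  refine ⟨?_, ?_, ?_, ?_, ?_, ?_⟩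
  all_goals
    rw [partialDeriv_w_apply, sum_S, c_e1, c_neg_e1, c_e2, c_neg_e2, c_e12, c_neg_e12]
    simp only [mFourier_neg, e12_eq, mFourier_add, Pi.neg_apply, Pi.add_apply, e1_0, e1_1, e1_2, e2_0,
      e2_1, e2_2]
    simp [Complex.mul_re, Complex.mul_im, Complex.conj_re, Complex.conj_im]


/-! ## 3. `p, q, r`; `|ω|² = p² + q² + r²`, `σ = −pqr` -/

/-- `p(x) = ∂₁w₀(x)` in characters. [ours; bookkeeping] -/
def pX (x : UnitAddTorus (Fin 3)) : ℝ := 2 * Real.pi * (-2 * (mFourier e2 x).im)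
/-- `q(x) = ∂₀w₂(x)` in characters. [ours; bookkeeping] -/
def qX (x : UnitAddTorus (Fin 3)) : ℝ := 2 * Real.pi * (-2 * (mFourier e1 x).im +
    2 * ((mFourier e1 x).re * (mFourier e2 x).re - (mFourier e1 x).im * (mFourier e2 x).im))
/-- `r(x) = ∂₁w₂(x)` in characters. [ours; bookkeeping] -/
def rX (x : UnitAddTorus (Fin 3)) : ℝ := 2 * Real.pi *
    (2 * ((mFourier e1 x).re * (mFourier e2 x).re - (mFourier e1 x).im * (mFourier e2 x).im))

/-- **`|ω(x)|² = p² + q² + r²`** for the three-wave field. [ours; elementary] -/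
theorem torusVorticitySqAt_w (x : UnitAddTorus (Fin 3)) :
    torusVorticitySqAt w x = pX x ^ 2 + qX x ^ 2 + rX x ^ 2 := by
  obtain ⟨h00, h01, h11, h20, h21, h22⟩ := partialDeriv_w_zero x
  unfold torusVorticitySqAt
  simp only [Fin.sum_univ_three, h00, h01, h11, h20, h21, h22, partialDeriv_one_w_zero,
    partialDeriv_zero_w_two, partialDeriv_one_w_two, pX, qX, rX]
  ring

/-- **`σ(x) = −p q r`** for the three-wave field (from the definition of `torusStretchingDensity`).
[ours; elementary] -/
theorem torusStretchingDensity_w (x : UnitAddTorus (Fin 3)) :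
    torusStretchingDensity w x = -(pX x * qX x * rX x) := by
  obtain ⟨h00, h01, h11, h20, h21, h22⟩ := partialDeriv_w_zero x
  unfold torusStretchingDensity torusVorticityTensor
  simp only [Fin.sum_univ_three, h00, h01, h11, h20, h21, h22, partialDeriv_one_w_zero,
    partialDeriv_zero_w_two, partialDeriv_one_w_two, pX, qX, rX]
  ring

/-- **`‖S(x)‖_F² = |ω(x)|²/2`** for the three-wave field (`S` off-diagonal with entries `p/2, q/2, r/2`).
[ours; elementary] -/
theorem strain_frobeniusSq_w (x : UnitAddTorus (Fin 3)) :
    ∑ i, ∑ j, ((Torus.partialDeriv j w x i + Torus.partialDeriv i w x j) / 2) ^ 2 =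
      (pX x ^ 2 + qX x ^ 2 + rX x ^ 2) / 2 := by
  obtain ⟨h00, h01, h11, h20, h21, h22⟩ := partialDeriv_w_zero x
  simp only [Fin.sum_univ_three, h00, h01, h11, h20, h21, h22, partialDeriv_one_w_zero,
    partialDeriv_zero_w_two, partialDeriv_one_w_two, pX, qX, rX]
  ring

/-- **`det S(x) = p q r / 4`** for the three-wave field (`S` off-diagonal with entries `p/2, q/2, r/2`;
so `σ = −4 det S`, the 2.5D structural zero). [ours; elementary] -/
theorem strain_det_w (x : UnitAddTorus (Fin 3)) :
    (Matrix.of fun i j : Fin 3 => (Torus.partialDeriv j w x i + Torus.partialDeriv i w x j) / 2).det =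
      pX x * qX x * rX x / 4 := by
  obtain ⟨h00, h01, h11, h20, h21, h22⟩ := partialDeriv_w_zero x
  rw [Matrix.det_fin_three]
  simp only [Matrix.of_apply, h00, h01, h11, h20, h21, h22, partialDeriv_one_w_zero,
    partialDeriv_zero_w_two, partialDeriv_one_w_two, pX, qX, rX]
  ring

/-- `|p(x)| ≤ 4π` (`p = −4π·Im Y`, `|Y| = 1`). [ours; elementary] -/
theorem abs_pX_le (x : UnitAddTorus (Fin 3)) : |pX x| ≤ 4 * Real.pi := by
  have him2 : (mFourier e2 x).im ^ 2 ≤ 1 := by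
    nlinarith [normSq_mFourier e2 x, sq_nonneg (mFourier e2 x).re]
  have h : pX x ^ 2 ≤ (4 * Real.pi) ^ 2 := by
    have e : pX x ^ 2 = 16 * Real.pi ^ 2 * (mFourier e2 x).im ^ 2 := by unfold pX; ring
    rw [e]
    nlinarith [mul_le_mul_of_nonneg_left him2 (by positivity : (0:ℝ) ≤ 16 * Real.pi ^ 2)]
  exact abs_le_of_sq_le_sq h (by positivity)

/-- **`|ω(x)|² ≤ 24·(2π)² = 96π²`** pointwise (`96π² − |ω|² = 16π²·(SOS)` modulo `|X| = |Y| = 1`).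
[ours; elementary] -/
theorem vorticitySq_le_w (x : UnitAddTorus (Fin 3)) : pX x ^ 2 + qX x ^ 2 + rX x ^ 2 ≤ 96 * Real.pi ^ 2 := by
  have hX := normSq_mFourier e1 x
  have hY := normSq_mFourier e2 x
  have key : 96 * Real.pi ^ 2 - (pX x ^ 2 + qX x ^ 2 + rX x ^ 2) = 16 * Real.pi ^ 2 *
      ((mFourier e2 x).re ^ 2 + 3 * ((mFourier e1 x).re * (mFourier e2 x).im +
        (mFourier e1 x).im * (mFourier e2 x).re) ^ 2 + 2 * (mFourier e1 x).re ^ 2 +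
        (((mFourier e1 x).re * (mFourier e2 x).re - (mFourier e1 x).im * (mFourier e2 x).im) +
          (mFourier e1 x).im) ^ 2) := by
    simp only [pX, qX, rX]
    linear_combination ((-32 : ℝ) * Real.pi ^ 2 + (-48 : ℝ) * Real.pi ^ 2 * (mFourier e2 x).im ^ 2 + (-48 : ℝ) * Real.pi ^ 2 * (mFourier e2 x).re ^ 2) * hX + ((-64 : ℝ) * Real.pi ^ 2) * hY
  have hnn : 0 ≤ 16 * Real.pi ^ 2 *
      ((mFourier e2 x).re ^ 2 + 3 * ((mFourier e1 x).re * (mFourier e2 x).im +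
        (mFourier e1 x).im * (mFourier e2 x).re) ^ 2 + 2 * (mFourier e1 x).re ^ 2 +
        (((mFourier e1 x).re * (mFourier e2 x).re - (mFourier e1 x).im * (mFourier e2 x).im) +
          (mFourier e1 x).im) ^ 2) := by positivity
  linarith

/-! ## 4. The middle strain eigenvalue of `w` is `≤ 2π` everywhere -/

/-- `Λ = 2π` (an admissible uniform bound for `λ₂(S(x))`; the sharp sup is `(√3 − 1)·2π`). [ours; bookkeeping] -/
def Λ : ℝ := 2 * Real.pi

/-- `0 ≤ Λ`. [ours; bookkeeping] -/
theorem Λ_nonneg : 0 ≤ Λ := by unfold Λ; positivity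

/-- `card (Fin 3) = 3` (the `hd` witness of the candidate). [folklore] -/
theorem card_fin_three : Fintype.card (Fin 3) = 3 := by simp

/-- **`λ₂(S(x)) ≤ |p(x)|/2 ≤ 2π` for all `x`** (any Hermitian-ness witness `hx`, any `card` witness `hd`):
the determinant branch at `t = |p|/2`, where `det(t − S) = −|p|(q ± r)²/8 ≤ 0` (Cauchy interlacing for the
principal `2×2` block `[[0, p/2], [p/2, 0]]`, done by hand). [ours; elementary] -/
theorem middleEigenvalue_le_w (hd : Fintype.card (Fin 3) = 3) (x : UnitAddTorus (Fin 3))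
    (hx : (Matrix.of fun i j =>
      (Torus.partialDeriv j w x i + Torus.partialDeriv i w x j) / 2).IsHermitian) :
    hx.eigenvalues₀ (Fin.cast hd.symm 1) ≤ Λ := by
  set M : Matrix (Fin 3) (Fin 3) ℝ :=
    Matrix.of fun i j => (Torus.partialDeriv j w x i + Torus.partialDeriv i w x j) / 2 with hM
  have hsym : M.IsSymm := Matrix.IsSymm.ext fun i j => by simp only [hM, Matrix.of_apply]; ring
  have htr : M.trace = 0 := by
    obtain ⟨h00, h01, h11, h20, h21, h22⟩ := partialDeriv_w_zero x
    simp only [hM, Matrix.trace, Matrix.diag, Matrix.of_apply, Fin.sum_univ_three, h00, h11, h22]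
    norm_num
  have hdet : M.det = pX x * qX x * rX x / 4 := strain_det_w x
  have hF : ∑ i, ∑ j, M i j ^ 2 = (pX x ^ 2 + qX x ^ 2 + rX x ^ 2) / 2 := by
    simp only [hM, Matrix.of_apply]
    exact strain_frobeniusSq_w x
  have ht : hx.eigenvalues₀ (Fin.cast hd.symm 1) ≤ |pX x| / 2 := by
    apply middle_le_of_det_branch hd M hsym htr hx (by positivity)
    rw [hF, hdet]
    rcases le_or_gt 0 (pX x) with hp | hp
    · rw [abs_of_nonneg hp]
      nlinarith [mul_nonneg hp (sq_nonneg (qX x + rX x))]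
    · rw [abs_of_neg hp]
      nlinarith [mul_nonneg (neg_nonneg.2 hp.le) (sq_nonneg (qX x - rX x))]
  have hp := abs_pX_le x
  unfold Λ
  linarith

end MiddleEigenKill

end Summit.NavierStokesRegularity.FunctionalMining

end
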